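import Literature.Analysis.ValidatedNumerics.TaylorModelIntegralCert2DAdaptive
import HarnessLib

/-!
# Kernel-checked RANGE certificates for `BExprE` functions of two variables on boxes
# (upper bounds by bivariate Taylor models over a kd-partition)

Trunk T-ANA (Analysis/ValidatedNumerics); namespace `Literature.Analysis.ValidatedNumerics.PolyMP`.
The double-integral certificates of `TaylorModelIntegralCert2DElem.lean` / `…2DAdaptive.lean` model an expression
`E : BExprE` (rational constants, `x`, `y`, `±`, `·`, `exp`, `log`, `⁻¹`, `√`) on a box by a bivariate Taylor model
(`BExprE.model`, sound by `tmem2_model`) and integrate the model.  The OTHER classical use of the same model is RANGE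
BOUNDING (interval global optimisation: Makino–Berz, "naive interval evaluation of the Taylor polynomial" plus the
remainder, over a partition of the domain box): `f ≤ b` on a box follows from `tupper2 ≤ b·S` for an accepted model
(`le_tupper2`), and a claim on a big box follows from the claims on the two halves of a split.  This file packages
exactly that, so that a real inequality `E(x, y) ≤ b` on a rectangle is proved by a handful of `decide +kernel`
leaves glued by split lemmas:

* `Box2Q.Forall B Q` — the predicate `Q x y` holds at every real point of the closed rational box `B`
  (`Box2Q` of `…2DAdaptive.lean`); `Box2Q.Forall.mono`; **`Box2Q.forall_of_splitX` / `forall_of_splitY`** (the two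
  halves of a cut at a rational abscissa / ordinate cover the box);
* **`BExprE.rangeLeafOK S P E B b`** (computable, kernel-reducible: the model of `E` about the centre of `B` with the
  half-widths of `B` is accepted and its scaled upper range bound is `≤ b·S`) and **`BExprE.forall_le_of_rangeLeafOK`**:
  then `E.toFun₂ x y ≤ b` at every point of `B` (positivity of the arguments of `log` and non-vanishing of those of
  `⁻¹` on the box FOLLOW from acceptance, as in the integral certificates);
* `RTree` (leaf with its own `EPrm` | `splitX c l r` | `splitY c l r`), the one-shot checker `RTree.check` with
  **`RTree.forall_le_of_check`**, and the leaf list `RTree.leaves` with **`RTree.forall_of_leaves`** (prove each leaf by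
  its own `decide`, or any other means, and glue).

Typical use (a transcendental inequality in two real variables on a rectangle, e.g. a parametric integral already in
closed form): generate the partition off-line by bisection until `rangeLeafOK` accepts (the flag and the bound are
re-checked by the kernel), then either `RTree.forall_le_of_check … (by decide +kernel)` in one go or one `decide` per
leaf glued by `forall_of_splitX/Y`.  Lower bounds: apply to `BExprE.neg E`.  Deliberately NOT here: boxes of
dimension `≠ 2`, monotonicity / derivative tests, minimiser localisation (see `TaylorModelExtremaCert.lean` for the
univariate variation-table machinery).  Problem-independent; no facts, no axioms; all certificate data computable
over `ℤ`.

## References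

* K. Makino, M. Berz, *Taylor models and other validated functional inclusion methods*, Int. J. Pure Appl. Math. 4
  (2003) 379–456: Definition 1 (Taylor model on a box), Definition 2 and §5 (bound `B(P)` of the polynomial part by
  naive interval evaluation; range bounding `f(D) ⊂ B(P) + I`). [cite: MakinoBerz2003, Definition 2]
* R. E. Moore, *Interval Analysis*, Prentice-Hall (1966), §4.4 (refinement of range bounds by subdivision of the
  box). [cite: Moore1966, Ch. 3–4]
-/

namespace Literature.Analysis.ValidatedNumerics

namespace PolyMP

open Literature.Analysis.ValidatedNumerics.NumericsMP

/-! ### Claims on all real points of a rational box -/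

/-- `Q x y` at every real point `(x, y)` of the closed box `[x0, x1] × [y0, y1]` (the claim format of range bounding
over a box). [cite: Moore1966, Ch. 3–4] -/
def Box2Q.Forall (B : Box2Q) (Q : ℝ → ℝ → Prop) : Prop :=
  ∀ x y : ℝ, (B.x0 : ℝ) ≤ x → x ≤ (B.x1 : ℝ) → (B.y0 : ℝ) ≤ y → y ≤ (B.y1 : ℝ) → Q x y

/-- Monotonicity of the box claim in the predicate. [cite: Moore1966, Ch. 3–4] -/
theorem Box2Q.Forall.mono {B : Box2Q} {Q Q' : ℝ → ℝ → Prop} (hQ : ∀ x y, Q x y → Q' x y)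
    (h : B.Forall Q) : B.Forall Q' :=
  fun x y h1 h2 h3 h4 => hQ x y (h x y h1 h2 h3 h4)

/-- **The two parts of a cut at the abscissa `c` cover the box.** [cite: Moore1966, Ch. 3–4] -/
theorem Box2Q.forall_of_splitX (B : Box2Q) (c : ℚ) {Q : ℝ → ℝ → Prop}
    (h₁ : (⟨B.x0, c, B.y0, B.y1⟩ : Box2Q).Forall Q) (h₂ : (⟨c, B.x1, B.y0, B.y1⟩ : Box2Q).Forall Q) :
    B.Forall Q := by
  intro x y h1 h2 h3 h4
  rcases le_total x (c : ℝ) with hc | hc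
  · exact h₁ x y h1 hc h3 h4
  · exact h₂ x y hc h2 h3 h4

/-- **The two parts of a cut at the ordinate `c` cover the box.** [cite: Moore1966, Ch. 3–4] -/
theorem Box2Q.forall_of_splitY (B : Box2Q) (c : ℚ) {Q : ℝ → ℝ → Prop}
    (h₁ : (⟨B.x0, B.x1, B.y0, c⟩ : Box2Q).Forall Q) (h₂ : (⟨B.x0, B.x1, c, B.y1⟩ : Box2Q).Forall Q) :
    B.Forall Q := by
  intro x y h1 h2 h3 h4
  rcases le_total y (c : ℝ) with hc | hc
  · exact h₁ x y h1 h2 h3 hc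
  · exact h₂ x y h1 h2 hc h4

/-- A box claim restricted to a sub-box (coordinate-wise containment: inclusion isotonicity). [cite: Moore1966, Ch. 3–4] -/
theorem Box2Q.Forall.of_le {B B' : Box2Q} {Q : ℝ → ℝ → Prop} (h : B.Forall Q)
    (hx0 : B.x0 ≤ B'.x0) (hx1 : B'.x1 ≤ B.x1) (hy0 : B.y0 ≤ B'.y0) (hy1 : B'.y1 ≤ B.y1) : B'.Forall Q := by
  intro x y h1 h2 h3 h4
  have e0 : (B.x0 : ℝ) ≤ B'.x0 := by exact_mod_cast hx0
  have e1 : (B'.x1 : ℝ) ≤ B.x1 := by exact_mod_cast hx1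
  have e2 : (B.y0 : ℝ) ≤ B'.y0 := by exact_mod_cast hy0
  have e3 : (B'.y1 : ℝ) ≤ B.y1 := by exact_mod_cast hy1
  exact h x y (e0.trans h1) (h2.trans e1) (e2.trans h3) (h4.trans e3)

/-! ### The leaf certificate: an accepted Taylor model whose upper range bound is `≤ b` -/

/-- **Range leaf check**: the box model of `E` about the centre of `B` with the half-widths of `B` (parameters `P`)
is accepted, and its scaled naive upper range bound is at most `b · S`. [cite: MakinoBerz2003, Definition 2] -/
def BExprE.rangeLeafOK (S : ℕ) (P : EPrm) (E : BExprE) (B : Box2Q) (b : ℚ) : Bool :=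
  let h := (B.x1 - B.x0) / 2
  let k := (B.y1 - B.y0) / 2
  let m := E.model S h k P ((B.x0 + B.x1) / 2) ((B.y0 + B.y1) / 2)
  decide (0 < S) && m.2 && decide ((tupper2 S h k m.1 : ℚ) ≤ b * S)

/-- **Soundness of the range leaf check**: `E(x, y) ≤ b` at every point of the box.
[cite: MakinoBerz2003, Definition 2] -/
theorem BExprE.forall_le_of_rangeLeafOK {S : ℕ} {P : EPrm} {E : BExprE} {B : Box2Q} {b : ℚ}
    (hok : E.rangeLeafOK S P B b = true) : B.Forall fun x y => E.toFun₂ x y ≤ b := by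
  unfold BExprE.rangeLeafOK at hok
  simp only [Bool.and_eq_true, decide_eq_true_eq] at hok
  obtain ⟨⟨hS, hflag⟩, hle⟩ := hok
  intro x y h1 h2 h3 h4
  set h : ℚ := (B.x1 - B.x0) / 2 with hh
  set k : ℚ := (B.y1 - B.y0) / 2 with hk
  set cx : ℚ := (B.x0 + B.x1) / 2 with hcx
  set cy : ℚ := (B.y0 + B.y1) / 2 with hcy
  have h01 : (B.x0 : ℝ) ≤ B.x1 := h1.trans h2
  have h01' : B.x0 ≤ B.x1 := by exact_mod_cast h01
  have k01 : (B.y0 : ℝ) ≤ B.y1 := h3.trans h4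
  have k01' : B.y0 ≤ B.y1 := by exact_mod_cast k01
  have h0 : 0 ≤ h := by rw [hh]; linarith
  have k0 : 0 ≤ k := by rw [hk]; linarith
  have hm := tmem2_model hS h0 k0 P cx cy E hflag
  have hρ : |x - (cx : ℝ)| ≤ (h : ℝ) := by
    rw [hcx, hh]; push_cast; rw [abs_le]; constructor <;> linarith
  have hσ : |y - (cy : ℝ)| ≤ (k : ℝ) := by
    rw [hcy, hk]; push_cast; rw [abs_le]; constructor <;> linarith
  have hup := le_tupper2 h0 k0 hm hρ hσ
  have ex : (cx : ℝ) + (x - cx) = x := by ring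
  have ey : (cy : ℝ) + (y - cy) = y := by ring
  simp only [ex, ey] at hup
  have hSr : (0 : ℝ) < S := by exact_mod_cast hS
  have hle' : ((tupper2 S h k (E.model S h k P cx cy).1 : ℤ) : ℝ) ≤ (b : ℝ) * S := by
    have := hle
    exact_mod_cast this
  exact le_of_mul_le_mul_right (hup.trans hle') hSr

/-! ### kd-partitions: one-shot checker and leaf lists -/

/-- A kd-partition of a box for range certificates: a leaf carries its own Taylor-model parameters; an inner node
cuts the current box at the abscissa `c` (`splitX`) or the ordinate `c` (`splitY`). [cite: Moore1966, Ch. 3–4] -/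
inductive RTree : Type
  /-- a leaf, modelled with parameters `P` -/
  | leaf (P : EPrm) : RTree
  /-- cut at `x = c`: `l` certifies `[x0, c] × [y0, y1]`, `r` certifies `[c, x1] × [y0, y1]` -/
  | splitX (c : ℚ) (l r : RTree) : RTree
  /-- cut at `y = c`: `l` certifies `[x0, x1] × [y0, c]`, `r` certifies `[x0, x1] × [c, y1]` -/
  | splitY (c : ℚ) (l r : RTree) : RTree

namespace RTree

/-- **One-shot range checker**: every leaf of the partition of `B` passes `rangeLeafOK`.
[cite: MakinoBerz2003, Definition 2] -/
def check (S : ℕ) (E : BExprE) (b : ℚ) : RTree → Box2Q → Bool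
  | leaf P, B => E.rangeLeafOK S P B b
  | splitX c l r, B => check S E b l ⟨B.x0, c, B.y0, B.y1⟩ && check S E b r ⟨c, B.x1, B.y0, B.y1⟩
  | splitY c l r, B => check S E b l ⟨B.x0, B.x1, B.y0, c⟩ && check S E b r ⟨B.x0, B.x1, c, B.y1⟩

/-- **Soundness of the one-shot checker**: `E(x, y) ≤ b` on the whole box. [cite: MakinoBerz2003, Definition 2] -/
theorem forall_le_of_check {S : ℕ} {E : BExprE} {b : ℚ} :
    ∀ (t : RTree) (B : Box2Q), t.check S E b B = true → B.Forall fun x y => E.toFun₂ x y ≤ b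
  | leaf P, B, h => BExprE.forall_le_of_rangeLeafOK (P := P) h
  | splitX c l r, B, h => by
    simp only [check, Bool.and_eq_true] at h
    exact B.forall_of_splitX c (forall_le_of_check l _ h.1) (forall_le_of_check r _ h.2)
  | splitY c l r, B, h => by
    simp only [check, Bool.and_eq_true] at h
    exact B.forall_of_splitY c (forall_le_of_check l _ h.1) (forall_le_of_check r _ h.2)

/-- The leaf boxes of the partition of `B`, in order, with their parameters. [cite: Moore1966, Ch. 3–4] -/
def leaves : RTree → Box2Q → List (Box2Q × EPrm)
  | leaf P, B => [(B, P)]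
  | splitX c l r, B => leaves l ⟨B.x0, c, B.y0, B.y1⟩ ++ leaves r ⟨c, B.x1, B.y0, B.y1⟩
  | splitY c l r, B => leaves l ⟨B.x0, B.x1, B.y0, c⟩ ++ leaves r ⟨B.x0, B.x1, c, B.y1⟩

/-- **Gluing leaf claims**: a predicate that holds on every leaf box holds on the whole box (use with one kernel
obligation per leaf). [cite: Moore1966, Ch. 3–4] -/
theorem forall_of_leaves {Q : ℝ → ℝ → Prop} :
    ∀ (t : RTree) (B : Box2Q), (∀ l ∈ t.leaves B, l.1.Forall Q) → B.Forall Q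
  | leaf P, B, h => h (B, P) (by simp [leaves])
  | splitX c l r, B, h => by
    refine B.forall_of_splitX c (forall_of_leaves l _ fun x hx => h x ?_) (forall_of_leaves r _ fun x hx => h x ?_)
    · simp only [leaves, List.mem_append]; exact Or.inl hx
    · simp only [leaves, List.mem_append]; exact Or.inr hx
  | splitY c l r, B, h => by
    refine B.forall_of_splitY c (forall_of_leaves l _ fun x hx => h x ?_) (forall_of_leaves r _ fun x hx => h x ?_)
    · simp only [leaves, List.mem_append]; exact Or.inl hx
    · simp only [leaves, List.mem_append]; exact Or.inr hx

/-- The one-shot checker is the conjunction of the leaf checks of the partition. [cite: MakinoBerz2003, Definition 2] -/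
theorem check_eq_all (S : ℕ) (E : BExprE) (b : ℚ) :
    ∀ (t : RTree) (B : Box2Q), t.check S E b B = (t.leaves B).all fun l => E.rangeLeafOK S l.2 l.1 b
  | leaf P, B => by simp [check, leaves]
  | splitX c l r, B => by simp only [check, leaves, List.all_append, check_eq_all S E b l, check_eq_all S E b r]
  | splitY c l r, B => by simp only [check, leaves, List.all_append, check_eq_all S E b l, check_eq_all S E b r]

end RTree

/-! ### Kernel test -/

/-- A genuinely two-variable kernel test: `log (1 + x y) ≤ 3/4` on `[0, 1]²` (`log 2 = 0.693…`), certified by three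
leaves of total degree 4 at scale `2³⁰`. [folklore] -/
example : (⟨0, 1, 0, 1⟩ : Box2Q).Forall fun x y =>
    (BExprE.log (BExprE.add (BExprE.const 1) (BExprE.mul BExprE.varX BExprE.varY))).toFun₂ x y
      ≤ (((3 : ℚ) / 4 : ℚ) : ℝ) :=
  RTree.forall_le_of_check (S := 2 ^ 30)
    (E := BExprE.log (BExprE.add (BExprE.const 1) (BExprE.mul BExprE.varX BExprE.varY))) (b := (3 : ℚ) / 4)
    (RTree.splitX ((1 : ℚ) / 2) (.leaf ⟨4, 5, 4, 2, 30, 2⟩)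
      (RTree.splitY ((1 : ℚ) / 2) (.leaf ⟨4, 5, 4, 2, 30, 2⟩) (.leaf ⟨4, 5, 4, 2, 30, 2⟩))) ⟨0, 1, 0, 1⟩
    (by decide +kernel)

end PolyMP

end Literature.Analysis.ValidatedNumerics
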